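import Summits.ResolutionOfSingularities.ResolutionOfSingularities.Theses.FrobeniusClosing
import HarnessLib

/-!
# Crux `Steer` (stmt-ResolutionOfSingularities-16345) — birth skeleton (BC3), line `birth`

Route `ResolutionOfSingularities/FrobeniusClosing`, crux #3 (rank 3, difficulty open-problem; the item is
shared verbatim with routes `WildCones` and `JacobianBudget`):
`Steer` = `IsolatedForcedTermination → ∀ p prime, (local uniformization of α_p-torsors over bases regular
at the centre, along every valuation, over every PERFECT ground field of characteristic p)` — the
consequent is verbatim the body of `TorsorLUPerfect` (stmt-16158 = Valuative's `LuAlphaPTorsor` +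
`[PerfectField k]`).

## The cut (three named stubs; `Steer_of` proved)

The planner's own foreseen split (route header, TWO-LAYER PLAN: "Steer ⇐ UnforcedReturn → Dictionary
→ Steer", with "0-dimensional reduction NovacoskiSpivakovsky2014, Cohen coefficient fields over perfect κ,
toroidal endgame" named as the dictionary's ingredients) typed over ONE explicit middle object:

* `SteeredWin p` — **the combined forced/unforced process terminates under SOME centre rule**: in the
  α_p-torsor base-blow-up game of route `ShadowGame` (positions = cleaned coefficient functions
  `c : ℕⁿ → κ` of `Z^p = a` over a perfect field `κ`; the resolver picks a non-empty set `F` of coordinates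
  = the regular centre `V(u_j : j ∈ F)` of the base; nature/the valuation picks the chart `i ∈ F` and the
  translation `τ`; the move generator `step` is ShadowGame's VERBATIM — blow up, divide `Z` by the maximal
  `p`-th power of `u_i`, translate, clean), the resolver has a FULL-INFORMATION POSITIONAL winning strategy
  `strat : state → F` over every perfect `κ`: every compliant play reaches a terminal state (cleaned series
  `0`, or a monomial of degree `≤ 1`, or a unique minimal exponent). It sits strictly between the two
  neighbouring routes' certificates: ShadowGame's `ShadowGameWin` (a UNIFORM strategy reading only SHADOWS)
  implies it (forget the shadows; reachability games are positionally determined — attractor ranks), and it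
  implies `TorsorLUPerfect` at `p` through the dictionary (stubs 3 + 1 below). The route review attached to
  this item (WildCones_engine_review.md, 2026-08-16) asked for exactly this object: "strengthen the
  antecedent to a statement the unforced regime consumes (termination of the COMBINED forced/unforced
  process under an explicit centre rule)". Here it is the waist of the skeleton, so that the one place
  where `IsolatedForcedTermination` can be consumed is isolated in ONE stub (`stub_steering`) and the
  valuation-theoretic bookkeeping is not charged to it.

* `stub_zeroDimReduction` — **torsor LU at zero-dimensional valuations ⇒ torsor LU at all valuations
  (TRUE; size M).** `TorsorLUZeroDim p → TorsorLU p`, where zero-dimensional = every `x ∈ O` is a root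
  modulo `𝔪_O` of a non-zero polynomial over `k` (residue field algebraic over `k`; the closed points of
  `Zar(K/k)`), typed exactly as in the tree's `relLU_of_relLU_zeroDim`
  (`Literature/AlgebraicGeometry/Resolution/LocalUniformizationClosedPoints.lean`). Unlike the relative-LU
  reduction landed there, the torsor version must carry the hypothesis "A₀ regular at the centre" DOWN to a
  refinement `O' ≤ O`, whose centre on `A₀` is a larger prime: first shrink — the regular locus of the f.g.
  `k`-algebra `A₀` is open (`isOpen_regularLocus_of_finiteType_field`) and contains the centre `Q`, so some
  `g ∈ A₀ ∖ Q` has `D(g) ⊆ Reg A₀`; `g` is a unit of `O`, and `A₁ := A₀[g⁻¹] ⊆ O` is f.g., regular at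
  EVERY prime, with `t^p ∈ A₁`, `Frac(A₁[t]) = K`; then refine `O` to `O'` minimal over `A₁[t]`
  (`exists_minimal_valuationSubring_le`), which is zero-dimensional (`exists_aeval_mem_nonunits_of_minimal`,
  Zariski's lemma), uniformize there, and descend regularity at the centre to the coarsening `O`
  (`isRegularLocalRing_centre_of_le`, Serre). Why it is not bookkeeping: it is the step that makes every
  centre along the run a CLOSED point with residue field finite over the perfect `k` (hence perfect), which
  is what the coefficient calculus of `SteeredWin` needs; NovacoskiSpivakovsky2014 / Zariski–Samuel VI §17.
* `stub_steering` — **forced termination ⇒ a steered win (the load-bearing stub; open-problem sized for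
  n ≥ 4).** `IsolatedForcedTermination → ∀ p prime, SteeredWin p`. Content (route header): at isolated
  multiplicity-`p` states play the point (`F = univ`; ShadowGame's `step` with `F = univ` is the route's
  point dynamics whenever the cleaned order is `< 2p`, and an isolated state of order `≥ 2p` has only
  non-isolated successors), at non-isolated (unforced) states play a positive-dimensional permissible
  coordinate stratum (maximal E-permissible, CossartPiltant2019-style) and show the play returns to the
  isolated regime or improves, with a ranking tying the excursions together. Why it might fail: the crux's
  own risk verbatim — the unforced regime may carry the whole difficulty (CossartPiltant2019 Rem. 3.2: ω
  rises under a permissible centre in dimension 4; Hauser–Perlega's cycles are unforced), and the attached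
  route review sharpens "may" to "does" for odd `p`, `n ≥ 3` (isolated points of cleaned order `> p` exit to
  a non-isolated equimultiple locus after ONE blow-up): then `IsolatedForcedTermination` buys nothing and
  this stub is a full-information `ShadowGameWin`. TRUE for `n ≤ 1` trivially (every one-variable state is
  terminal) and expected for `n ≤ 3` (resolution in dimension ≤ 3, CossartPiltant2019 Thm. 1.1, if the
  coordinate-stratum move alphabet suffices there — ShadowGame's calibration regime).
* `stub_dictionary` — **a steered win uniformizes α_p-torsors at zero-dimensional valuations (size L).**
  `∀ p prime, SteeredWin p → TorsorLUZeroDim p`: ShadowGame's `WinToTorsorLU` (stmt-16160) with a WEAKER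
  game hypothesis (any full-information positional strategy, chosen after `κ`) and only at valuation rings
  whose residue field `κ(O)` is algebraic over the perfect `k` (hence perfect): the centre of `O` on every
  f.g. model is then a closed point, Cohen coefficient fields containing `k` are unique and compatible
  along the finite residue tower inside `κ(O)`, the expansion of `a = t^p` in exceptional-adapted regular
  parameters evolves exactly by `step` (blow up `(u_j : j ∈ F)` on the model, `i` = the chart the
  valuation selects, divide `t` by `u_i^k` inside `O`, translate by Teichmüller lifts of the new centre's
  coordinates in `κ(O)`), the resolver's `F` is read off the current expansion (full information is
  available on the algebraic side), and terminal states give LU (order ≤ 1 ⇒ `A[t']` regular at the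
  centre; cleaned series `0` ⇒ `t ∈ Frac A₀` by geometric regularity of formal fibres; unique minimal
  exponent ⇒ formally `Z^p = u^A·unit` ⇒ toroidal, resolved near the centre by log blow-ups, Kato1994
  (10.4) / Niziol2006 Thm. 5.8). Why it might fail: ShadowGame's named leaks (algebraicity of permissible
  cleanings `S ∩ Ŝ^p = S^p`, the toroidal endgame over non-closed residue fields) — each would force an
  extra move or terminal clause in `SteeredWin`, i.e. a reshaped waist, not a dead line.
* The assembly `Steer_of : Sig.stub_zeroDimReduction → Sig.stub_steering → Sig.stub_dictionary → Steer`
  is PROVED (pure composition, prime by prime; no `sorry` in its own term), and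
  `Steer_proof : Steer := Steer_of stub_zeroDimReduction stub_steering stub_dictionary` is the skeleton
  theorem (its only `sorry`s are the three stubs).

Disproof used: `Cruxes/Steer/Disproof.lean` (standing refuter, 2026-08-17T05:00Z, read at registration):
it files NO `_false_without_<H>` obstruction and NO refuted strengthening or `-- Targets` kill for this
crux; its kernel-checked findings are (i) identities — the three route copies of `Steer` are one
proposition and `Steer ↔ (IsolatedForcedTermination → ShadowGame.TorsorLUPerfect)` (`Iff.rfl`; this
file's `Steer_iff` is the same unfolding with `TorsorLU p` prime by prime); (ii) S → C —
`steer_of_resolutionOfSingularities`: the summit implies the crux, so `Steer` and every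
hypothesis-mutation of its consequent are irrefutable short of refuting resolution; (iii) the junk
analysis of the consequent inherited from `Cruxes/LuAlphaPTorsor/Disproof.lean` (`not_withoutFrac`,
`not_withoutFG`, `not_withoutTorsor` are junk-false mutations; `not_sameModel` a non-trivial inhabitant).
Honoured here: `TorsorLU` / `TorsorLUZeroDim` keep ALL hypotheses and conjuncts of the consequent
verbatim (no stub instantiates a junk-false mutation — in particular `A.FG`, `IsFractionRing A K` and the
torsor data `t ^ p ∈ A₀`, `Frac(A₀[t]) = K` are never dropped), and the only possible use of the
antecedent is confined to `stub_steering`, the one statement of the three that is NOT a consequence of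
the summit (a game win is stronger than LU) — so the disprover's verdict "modulo a proof of the target,
Steer ≡ TorsorLUPerfect" is exactly the question `stub_steering` isolates. `ledger negatives --problem
ResolutionOfSingularities`: 1 entry (DefectlessFrames stmt-19085), unrelated to torsor LU. Evidence used:
the route review WildCones_engine_review.md (structural objection: Steer ≈ LU of α_p-torsors modulo a
largely provable antecedent) — answered by making the combined-process termination `SteeredWin` the
explicit waist, so that provers and refuters can attack `stub_steering` (does forced termination buy
anything?) separately from the dictionary.
-/

-- single-problem summit: the doubled namespace component `ResolutionOfSingularities` is forced
set_option linter.dupNamespace false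

open Summit.ResolutionOfSingularities.ResolutionOfSingularities.Theses.FrobeniusClosing
  (Steer IsolatedForcedTermination)

namespace Summit.ResolutionOfSingularities.ResolutionOfSingularities.Cruxes.Steer.Lines.Birth

/-! ## The three predicates of the cut -/

/-- **Local uniformization of α_p-torsors over bases regular at the centre, over perfect ground fields
of characteristic `p`** — verbatim the consequent of the crux `Steer` at the prime `p` (= the body of
`TorsorLUPerfect`, stmt-16158, at `p`): `k` perfect of characteristic `p`, `K/k`, `O` a valuation ring
of `K`, `A₀ ⊆ O` f.g. and regular at the centre of `O`, `t ∈ K` with `t^p ∈ A₀` and `Frac(A₀[t]) = K`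
⇒ some f.g. `A` with `A₀[t] ⊆ A ⊆ O`, `Frac A = K`, `A` regular at the centre of `O`.
[cite: Temkin2013, Rem. 1.3.5; CutkoskyMourtada2019, §1] -/
def TorsorLU (p : ℕ) : Prop :=
  ∀ (k K : Type) [Field k] [CharP k p] [PerfectField k] [Field K] [Algebra k K]
    (O : ValuationSubring K) (A₀ : Subalgebra k K) (h₀ : A₀.toSubring ≤ O.toSubring) (t : K),
    A₀.FG → t ^ p ∈ A₀ → IsFractionRing (Algebra.adjoin k (insert t (A₀ : Set K))) K →
    IsRegularLocalRing (Localization.AtPrime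
      (Ideal.comap (Subring.inclusion h₀) (IsLocalRing.maximalIdeal O))) →
    ∃ (A : Subalgebra k K) (h : A.toSubring ≤ O.toSubring), A₀ ≤ A ∧ t ∈ A ∧ A.FG ∧
      IsFractionRing A K ∧ IsRegularLocalRing (Localization.AtPrime
        (Ideal.comap (Subring.inclusion h) (IsLocalRing.maximalIdeal O)))

/-- **The same, at ZERO-DIMENSIONAL valuation rings only**: the extra hypothesis says that every
`x ∈ O` is a root modulo `𝔪_O` of a non-zero polynomial over `k`, i.e. the residue field of `O` is
algebraic over `k` (`O` is a closed point of the Zariski–Riemann space of `K/k`), typed exactly as in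
the tree's `Literature.AlgebraicGeometry.Resolution.relLU_of_relLU_zeroDim`.
[cite: ZariskiSamuel1960, Ch. VI §17; NovacoskiSpivakovsky2014] -/
def TorsorLUZeroDim (p : ℕ) : Prop :=
  ∀ (k K : Type) [Field k] [CharP k p] [PerfectField k] [Field K] [Algebra k K]
    (O : ValuationSubring K) (A₀ : Subalgebra k K) (h₀ : A₀.toSubring ≤ O.toSubring) (t : K),
    (∀ x ∈ O, ∃ f : Polynomial k, f ≠ 0 ∧ Polynomial.aeval x f ∈ O.nonunits) →
    A₀.FG → t ^ p ∈ A₀ → IsFractionRing (Algebra.adjoin k (insert t (A₀ : Set K))) K →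
    IsRegularLocalRing (Localization.AtPrime
      (Ideal.comap (Subring.inclusion h₀) (IsLocalRing.maximalIdeal O))) →
    ∃ (A : Subalgebra k K) (h : A.toSubring ≤ O.toSubring), A₀ ≤ A ∧ t ∈ A ∧ A.FG ∧
      IsFractionRing A K ∧ IsRegularLocalRing (Localization.AtPrime
        (Ideal.comap (Subring.inclusion h) (IsLocalRing.maximalIdeal O)))

/-- **Steered win in the α_p-torsor base-blow-up game at the prime `p`** (the waist of the cut). For
every `n ≥ 1` and every perfect field `κ` of characteristic `p` the resolver has a full-information
POSITIONAL winning strategy `strat` (current cleaned coefficient function ↦ a non-empty set `F` of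
coordinates, the regular centre `V(u_j : j ∈ F)` of the base): for every start `c₀`, every chart
sequence `i` and translation sequence `t` of nature with `i m ∈ F_m` at every stage, the play
`c_{m+1} = step F_m (i m) (t m) c_m` reaches a terminal state (cleaned series `0`, a monomial of degree
`≤ 1`, or a unique minimal exponent) at some finite stage. The move generator (`clean`, `bl`, `mF`,
`dv`, `tr`, `step`) and `Terminal` are VERBATIM those of `ShadowGame.ShadowGameWin` (stmt-16159): blow
up `(u_j : j ∈ F)` in chart `i`, shift the `u_i`-exponent down by `p·⌊m_F/p⌋` (divide `Z` by the maximal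
`p`-th power of `u_i`), translate `u_j ↦ u_j + τ_j` (`j ∈ F`, `j ≠ i`; a finite sum by the
`u_i`-grading), delete the monomials with exponent in `pℕⁿ`. Implied by `ShadowGameWin` (uniform
shadow-measurable strategies are strategies; reachability games are positionally determined) and
implying `TorsorLU p` through `stub_dictionary` + `stub_zeroDimReduction`.
[cite: Spivakovsky1982, p. 1009 (Hironaka's game ⇒ local uniformization); Hironaka1967] -/
def SteeredWin (p : ℕ) : Prop :=
  ∀ n : ℕ, 0 < n → ∀ (κ : Type) [Field κ] [CharP κ p] [PerfectField κ],
    ∃ strat : ((Fin n → ℕ) → κ) → Finset (Fin n), (∀ c, (strat c).Nonempty) ∧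
    ∀ (c₀ : (Fin n → ℕ) → κ) (i : ℕ → Fin n) (t : ℕ → Fin n → κ),
    let clean : ((Fin n → ℕ) → κ) → ((Fin n → ℕ) → κ) :=
      fun c A => @ite κ (∀ j, p ∣ A j) (Classical.dec _) 0 (c A)
    let bl : Finset (Fin n) → Fin n → ((Fin n → ℕ) → κ) → ((Fin n → ℕ) → κ) :=
      fun F i c B => @ite κ (Finset.sum (F.erase i) (fun j => B j) ≤ B i) (Classical.dec _)
        (c (Function.update B i (B i - Finset.sum (F.erase i) (fun j => B j)))) 0
    let mF : Finset (Fin n) → ((Fin n → ℕ) → κ) → ℕ :=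
      fun F c => sInf {m : ℕ | ∃ A, c A ≠ 0 ∧ m = Finset.sum F (fun j => A j)}
    let dv : Fin n → ℕ → ((Fin n → ℕ) → κ) → ((Fin n → ℕ) → κ) :=
      fun i s c B => c (Function.update B i (B i + s))
    let tr : Finset (Fin n) → Fin n → (Fin n → κ) → ℕ → ((Fin n → ℕ) → κ) → ((Fin n → ℕ) → κ) :=
      fun F i τ s c B => Finset.sum (Fintype.piFinset (fun _ : Fin n => Finset.range (B i + s + 1)))
        (fun D => @ite κ (∀ j, j ∉ F.erase i → D j = 0) (Classical.dec _)
          (c (B + D) * Finset.prod (F.erase i)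
            (fun j => ((Nat.choose (B j + D j) (B j) : ℕ) : κ) * τ j ^ (D j))) 0)
    let step : Finset (Fin n) → Fin n → (Fin n → κ) → ((Fin n → ℕ) → κ) → ((Fin n → ℕ) → κ) :=
      fun F i τ c => clean (tr F i τ (p * (mF F (clean c) / p))
        (dv i (p * (mF F (clean c) / p)) (bl F i (clean c))))
    let Terminal : ((Fin n → ℕ) → κ) → Prop := fun c => (∀ A, clean c A = 0) ∨
      ∃ A, clean c A ≠ 0 ∧ (Finset.sum Finset.univ (fun j => A j) ≤ 1 ∨
        ∀ B, clean c B ≠ 0 → ∀ j, A j ≤ B j)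
    let run : ℕ → ((Fin n → ℕ) → κ) := fun m =>
      @Nat.rec (fun _ => (Fin n → ℕ) → κ) c₀ (fun m' c => step (strat c) (i m') (t m') c) m
    (∀ m, i m ∈ strat (run m)) → ∃ m, Terminal (run m)

/-! ## Sanity (proved): the crux unfolds to `IsolatedForcedTermination → ∀ p prime, TorsorLU p`, and
the zero-dimensional statement is a special case of the full one (so `stub_zeroDimReduction` states an
equivalence whose non-trivial direction is the stub). -/

/-- The crux `Steer`, unfolded: forced termination of isolated chains ⇒ torsor LU prime by prime.
[folklore] -/
theorem Steer_iff : Steer ↔ (IsolatedForcedTermination → ∀ p : ℕ, p.Prime → TorsorLU p) :=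
  Iff.rfl

/-- Torsor LU at all valuation rings trivially gives it at the zero-dimensional ones (drop the
hypothesis). [folklore] -/
theorem TorsorLU.zeroDim {p : ℕ} (h : TorsorLU p) : TorsorLUZeroDim p :=
  fun k K _ _ _ _ _ O A₀ h₀ t _ hfg htp hfr hreg => h k K O A₀ h₀ t hfg htp hfr hreg

/-! ## The three stub STATEMENTS by name (`Sig.stub_<name>`; the composition `Steer_of` takes exactly
these as hypotheses) -/

/-- Statement of `stub_zeroDimReduction`: torsor LU at zero-dimensional valuation rings ⇒ torsor LU
at every valuation ring, prime by prime. [cite: ZariskiSamuel1960, Ch. VI §17] -/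
def Sig.stub_zeroDimReduction : Prop :=
  ∀ p : ℕ, p.Prime → TorsorLUZeroDim p → TorsorLU p

/-- Statement of `stub_steering`: forced termination of isolated chains ⇒ a steered (full-information,
positional) win in the torsor base game, for every prime. [cite: CossartPiltant2019, Rem. 3.2;
HauserPerlega2019, §1] -/
def Sig.stub_steering : Prop :=
  IsolatedForcedTermination → ∀ p : ℕ, p.Prime → SteeredWin p

/-- Statement of `stub_dictionary`: a steered win ⇒ torsor LU at zero-dimensional valuation rings
(Cohen-expansion dictionary + terminal endgame). [cite: Spivakovsky1982, p. 1009; Kato1994, (10.4);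
Niziol2006, Thm. 5.8] -/
def Sig.stub_dictionary : Prop :=
  ∀ p : ℕ, p.Prime → SteeredWin p → TorsorLUZeroDim p

/-! ## The stubs -/

/-- **STUB (true, size M).** Zero-dimensional reduction for torsor LU: shrink `A₀` to `A₀[g⁻¹]`
regular everywhere (`isOpen_regularLocus_of_finiteType_field`, `g` a unit of `O`), refine `O` to a
valuation ring minimal over `A₀[g⁻¹][t]` (`exists_minimal_valuationSubring_le`; zero-dimensional by
`exists_aeval_mem_nonunits_of_minimal`), uniformize there, descend regularity at the centre to `O`
(`isRegularLocalRing_centre_of_le`). [cite: ZariskiSamuel1960, Ch. VI §17; NovacoskiSpivakovsky2014] -/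
theorem stub_zeroDimReduction (p : ℕ) (hp : p.Prime) (h : TorsorLUZeroDim p) : TorsorLU p := by
  sorry

/-- **STUB (load-bearing, open-problem sized).** Forced termination of isolated multiplicity-`p` chains
⇒ the resolver wins the full-information torsor base game over every perfect field: play the point at
isolated states, a maximal permissible coordinate stratum at unforced states, with a ranking tying the
excursions through the unforced regime together (module docstring).
[cite: CossartPiltant2019, Rem. 3.2; HauserPerlega2019, §1; Spivakovsky1982] -/
theorem stub_steering (hT : IsolatedForcedTermination) (p : ℕ) (hp : p.Prime) : SteeredWin p := by
  sorry

/-- **STUB (size L).** The dictionary at zero-dimensional valuation rings: centres are closed points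
with perfect residue fields inside `κ(O)`, Cohen expansions of `a = t^p` in exceptional-adapted
parameters evolve by `step`, the resolver's centre is read off the expansion, terminal states give LU
(order ≤ 1 / `p`-th power / toroidal endgame by log blow-ups) — ShadowGame's `WinToTorsorLU` with a
weaker game hypothesis. [cite: Spivakovsky1982, p. 1009; Artin1969; Kato1994, (10.4); Niziol2006,
Thm. 5.8] -/
theorem stub_dictionary (p : ℕ) (hp : p.Prime) (h : SteeredWin p) : TorsorLUZeroDim p := by
  sorry

/-! ## The composition (kernel-checked; no `sorry` in its own term) -/

/-- **`Steer` from the three stub statements** — the assembly, PROVED: given forced termination, at a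
prime `p` the steering stub gives a steered win, the dictionary turns it into torsor LU at
zero-dimensional valuation rings, and the zero-dimensional reduction into torsor LU at every valuation
ring, which is the consequent of `Steer` at `p` on the nose. [folklore] -/
theorem Steer_of :
    Sig.stub_zeroDimReduction → Sig.stub_steering → Sig.stub_dictionary → Steer :=
  fun hZ hS hD hT p hp => hZ p hp (hD p hp (hS hT p hp))

/-- **The crux `Steer`, assembled from the three registered stubs** (the skeleton in its final shape:
`Steer_of` with the `stub_*` plugged in; the only `sorry`s in its closure are the three stubs, none of
its own). -/
theorem Steer_proof : Steer :=
  Steer_of stub_zeroDimReduction stub_steering stub_dictionary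

end Summit.ResolutionOfSingularities.ResolutionOfSingularities.Cruxes.Steer.Lines.Birth
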